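import Literature.NumberTheory.Automorphic.UnitaryGroupBorelRefinedClassMap
import HarnessLib

/-!
# The characteristic-polynomial classes of `U(J₂)(F)` meeting the rational Borel `B(F)`
# — the index set of the unipotent ∕ hyperbolic terms of the fine `𝔬`-expansion in TWO variables
(Rogawski, *Automorphic Representations of Unitary Groups in Three Variables* (1990), §1.9 p. 9; §2.2–2.3
pp. 13–14: the classes `𝔬` with `𝔬 ∩ B(F) ≠ ∅`; §3.4–3.6 pp. 23–27; §7.3 p. 98 «Let `G = U(3)`, `U(2)`, or
`U(2) × U(1)`» and Prop. 7.3.1 (the central term of `U(2)` and `U(2) × U(1)`); §10.2 p. 153 (the trace formula of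
`G = U(2)` or `U(3)` and of its endoscopic group `H`); Arthur, *A trace formula for reductive groups I*, Duke Math.
J. 45 (1978), §8.)

Topic `NumberTheory/Automorphic`; namespace `Literature.NumberTheory.Automorphic.UnitaryGroup`. THEOREMS ONLY over
accepted tree modules: no definition, no named fact, no `sorry`, no instance, no notation. Brick H-B3 of the H-SIDE
copy of LAWS 1–5 (`H = U(Φ₂) × U(Φ₁)`, the rank-one quasi-split factor `U(Φ₂) = U(J₂)`) of the T1 line
`Cruxes/H413/Lines/F0_T1InnerFormTraceIdentity.lean` (cell `pub/hodgecm-mathlib`, crux H413; LEAD WORD #123,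
census `CENSUS-LAWS-Hside.F0P3a-p03g6.md`). It is the `N = 2` sibling of ★ `UnitaryGroupCharpolyBorelClasses`
(`N = 3`), whose §1 is stated for every `N` and is USED, not restated (★ `exists_diag_of_mem_arithmeticBorel`,
★ `exists_mem_arithmeticBorel_of_diag`).

For a quadratic `E/F` with involution `c`, `c² = 1`, and the quasi-split `U(J₂)` (rational torus
`T(F) = {d(a) = diag(a, (c a)⁻¹) : a ∈ Eˣ}`, `B = T N`):

* §2 **`exists_arithmeticBorel_charpoly_eq_iff_two`** — `(∃ β ∈ B(F), cl β = i) ↔ ∃ a ∈ Eˣ,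
  i = ((X − a)(X − (c a)⁻¹)).map (E → 𝔸_E)`, and its negated-filter form
  **`not_forall_arithmeticBorel_charpoly_ne_iff_two`**.
* §3 the **DICHOTOMY** of the classes meeting `B(F)`, intrinsic in `i`: (u) CENTRAL × unipotent `i = (X − z)²`,
  `z ∈ E¹` (`𝔬 ∋ z · 1`; the unipotent term, Prop. 7.3.1); (h) REGULAR HYPERBOLIC `i = (X − a)(X − (c a)⁻¹)`,
  `c a · a ≠ 1`, two distinct roots (the weighted orbital integrals of the split torus direction) —
  **`meetsBorel_dichotomy`** (exhaustive), the exclusion **`not_central_and_hyperbolic_two`**, and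
  **`hyperbolic_roots_ne_two`**. There is NO third («singular») case in two variables: a non-central diagonal
  `diag(a, b)` with `a ≠ b ∈ E¹` is a regular ELLIPTIC element and misses every rational Borel.
* §4 the same dichotomy for the BOREL-REFINED index `cl♭ = (charpoly ∘ adelicVal, flag)` of ★
  `UnitaryGroupBorelRefinedClassMap` (every `N`): **`not_forall_arithmeticBorel_borelRefine_charpoly_ne_iff_two`**
  («`i` meets `B(F)`» ⟺ `i.2 = true ∧ ∃ a, …`) and the two-way split of a filtered finite sum along it,
  **`sum_filter_meetsBorel_eq_sum_central_add_sum_hyperbolic_two`** — the shape in which the two `N = 2` sockets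
  will be plugged into the Borel-refined expansion of `J(f)`.

## References

* J. D. Rogawski, *Automorphic Representations of Unitary Groups in Three Variables*, Annals of Mathematics
  Studies 123 (1990), §1.9 (p. 9), §2.2–2.3 (pp. 13–14), §3.4–3.6 (pp. 23–27), §7.3 (p. 98), §10.2 (p. 153)
  [Rogawski1990].
* J. Arthur, *A trace formula for reductive groups I: terms associated to classes in `G(ℚ)`*, Duke Math. J. 45
  (1978), §8 [Arthur1978TraceFormulaI].
-/

set_option autoImplicit false

noncomputable section

open NumberField IsDedekindDomain Matrix Polynomial
open scoped Classical MatrixGroups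

namespace Literature.NumberTheory.Automorphic

namespace UnitaryGroup

variable {F E : Type} [Field F] [NumberField F] [Field E] [NumberField E] [Algebra F E]
  {c : E ≃ₐ[F] E}

/-! ## §2 `N = 2`: the classes meeting `B(F)` are the `(X − a)(X − (c a)⁻¹)`, `a ∈ Eˣ` -/

omit [NumberField F] [NumberField E] in
/-- `c (c x) = x` for an involution `c`. [folklore] -/
private theorem conj_conj_two (hc : c * c = 1) (x : E) : c (c x) = x := by
  rw [← AlgEquiv.mul_apply, hc, AlgEquiv.one_apply]

/-- **The classes meeting `B(F)`, `N = 2`, forward direction**: for `β ∈ B(F) ≤ U(J₂)(F)`,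
`cl β = ((X − a)(X − (c a)⁻¹)).map (E → 𝔸_E)` with `a ∈ Eˣ` — the diagonal `d(a) = diag(a, ā⁻¹)` of the
rational torus (★ `exists_diag_of_mem_arithmeticBorel` at `N = 2`: `d = (d₀, d₁)` with `c(d₀) d₁ = 1`).
[cite: Rogawski1990, §1.9 (p. 9); §2.2 (p. 13)] -/
theorem exists_charpoly_eq_of_mem_arithmeticBorel_two {β : (quasiSplit F E c 2).arithmeticSubgroup}
    (hβ : β ∈ arithmeticBorel F E c 2) :
    ∃ a : Eˣ,
      ((adelicVal F E c 2 _ (β : (quasiSplit F E c 2).Adelic) : GL (Fin 2) (AdeleRing (𝓞 E) E)) :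
          Matrix (Fin 2) (Fin 2) (AdeleRing (𝓞 E) E)).charpoly =
        ((X - C (a : E)) * (X - C (c (a : E))⁻¹)).map (algebraMap E (AdeleRing (𝓞 E) E)) := by
  obtain ⟨d, hd, hβd⟩ := exists_diag_of_mem_arithmeticBorel hβ
  refine ⟨d 0, ?_⟩
  rw [hβd, Fin.prod_univ_two]
  congr 2
  -- `d₁ = (c d₀)⁻¹` from `c(d₀) d₁ = 1`
  have h1 : c (d 0 : E) * (d 1 : E) = 1 := hd 1
  rw [eq_inv_of_mul_eq_one_right h1]

/-- **The classes meeting `B(F)`, `N = 2`, converse**: for `c² = 1`, every `a ∈ Eˣ` gives a rational torus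
element `d(a) = diag(a, (c a)⁻¹) ∈ T(F) ≤ B(F)` with `cl = ((X − a)(X − (c a)⁻¹)).map (E → 𝔸_E)`.
[cite: Rogawski1990, §1.9 (p. 9); §2.2 (p. 13)] -/
theorem exists_mem_arithmeticBorel_charpoly_eq_two (hc : c * c = 1) (a : Eˣ) :
    ∃ β : (quasiSplit F E c 2).arithmeticSubgroup, β ∈ arithmeticBorel F E c 2 ∧
      (β : (quasiSplit F E c 2).Adelic) ∈ torusAdelic F E c 2 ∧
      ((adelicVal F E c 2 _ (β : (quasiSplit F E c 2).Adelic) : GL (Fin 2) (AdeleRing (𝓞 E) E)) :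
          Matrix (Fin 2) (Fin 2) (AdeleRing (𝓞 E) E)).charpoly =
        ((X - C (a : E)) * (X - C (c (a : E))⁻¹)).map (algebraMap E (AdeleRing (𝓞 E) E)) := by
  have ha0 : c (a : E) ≠ 0 := by
    rw [map_ne_zero_iff _ c.injective]; exact a.ne_zero
  -- the second diagonal unit `(c a)⁻¹`
  set a' : Eˣ := Units.mk0 (c (a : E))⁻¹ (inv_ne_zero ha0) with ha'
  set d : Fin 2 → Eˣ := ![a, a'] with hdd
  have hd : ∀ i, c (d (Fin.rev i) : E) * (d i : E) = 1 := by
    intro i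
    fin_cases i
    · change c (a' : E) * (a : E) = 1
      rw [ha', Units.val_mk0, map_inv₀, conj_conj_two hc, inv_mul_cancel₀ a.ne_zero]
    · change c (a : E) * (a' : E) = 1
      rw [ha', Units.val_mk0, mul_inv_cancel₀ ha0]
  obtain ⟨β, hβB, hβT, hβd⟩ := exists_mem_arithmeticBorel_of_diag (F := F) (c := c) d hd
  refine ⟨β, hβB, hβT, ?_⟩
  rw [hβd, Fin.prod_univ_two]
  rfl

/-- **THE CLASSES MEETING `B(F)`, BY CHARACTERISTIC POLYNOMIAL** (`N = 2`, `c² = 1`): a class `i ∈ 𝔸_E[X]`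
of the characteristic-polynomial class map is the class of some `β ∈ B(F)` iff
`i = ((X − a)(X − (c a)⁻¹)).map (E → 𝔸_E)` for some `a ∈ Eˣ` — the negation of the filter `∀ β : B(F), cl β ≠ i`
of the off-Borel ∕ Borel split of `J(f)`; these are the classes whose constant terms `p_𝔬(0)` carry the unipotent
and the weighted hyperbolic contributions of `U(2)`. [cite: Rogawski1990, §2.2–2.3 (pp. 13–14); §7.3 (p. 98)]
[cite: Arthur1978TraceFormulaI, §8] -/
theorem exists_arithmeticBorel_charpoly_eq_iff_two (hc : c * c = 1) (i : (AdeleRing (𝓞 E) E)[X]) :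
    (∃ β : arithmeticBorel F E c 2,
      ((adelicVal F E c 2 _ ((β : (quasiSplit F E c 2).arithmeticSubgroup) : (quasiSplit F E c 2).Adelic) :
          GL (Fin 2) (AdeleRing (𝓞 E) E)) : Matrix (Fin 2) (Fin 2) (AdeleRing (𝓞 E) E)).charpoly = i) ↔
    ∃ a : Eˣ, i = ((X - C (a : E)) * (X - C (c (a : E))⁻¹)).map (algebraMap E (AdeleRing (𝓞 E) E)) := by
  constructor
  · rintro ⟨β, rfl⟩
    obtain ⟨a, h⟩ := exists_charpoly_eq_of_mem_arithmeticBorel_two (F := F) (c := c) β.2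
    exact ⟨a, h⟩
  · rintro ⟨a, rfl⟩
    obtain ⟨β, hβB, -, hβd⟩ := exists_mem_arithmeticBorel_charpoly_eq_two (F := F) hc a
    exact ⟨⟨β, hβB⟩, hβd⟩

/-- The same, phrased as the NEGATION of the `Finset.filter` predicate of the off-Borel ∕ Borel split:
`¬ (∀ β : B(F), cl β ≠ i) ↔ ∃ a, …`. [cite: Rogawski1990, §2.2–2.3 (pp. 13–14)] -/
theorem not_forall_arithmeticBorel_charpoly_ne_iff_two (hc : c * c = 1) (i : (AdeleRing (𝓞 E) E)[X]) :
    (¬ ∀ β : arithmeticBorel F E c 2,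
      ((adelicVal F E c 2 _ ((β : (quasiSplit F E c 2).arithmeticSubgroup) : (quasiSplit F E c 2).Adelic) :
          GL (Fin 2) (AdeleRing (𝓞 E) E)) : Matrix (Fin 2) (Fin 2) (AdeleRing (𝓞 E) E)).charpoly ≠ i) ↔
    ∃ a : Eˣ, i = ((X - C (a : E)) * (X - C (c (a : E))⁻¹)).map (algebraMap E (AdeleRing (𝓞 E) E)) := by
  rw [← exists_arithmeticBorel_charpoly_eq_iff_two hc i]
  simp only [ne_eq, not_forall, not_not]

/-! ## §3 `N = 2`: the dichotomy central × unipotent ∕ regular hyperbolic -/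

omit [NumberField E] in
/-- `x` is a root of `(X − a)(X − w)` iff `x ∈ {a, w}` (integral domain). [folklore] -/
private theorem isRoot_two_iff {a w x : E} :
    ((X - C a) * (X - C w)).IsRoot x ↔ x = a ∨ x = w := by
  simp only [Polynomial.IsRoot.def, eval_mul, eval_sub, eval_X, eval_C, mul_eq_zero, sub_eq_zero]

/-- The base change `E[X] → 𝔸_E[X]` is injective. [folklore] -/
private theorem map_adele_injective_two :
    Function.Injective (Polynomial.map (algebraMap E (AdeleRing (𝓞 E) E))) :=
  Polynomial.map_injective _ (AdeleRing.algebraMap_injective (𝓞 E) E)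

omit [NumberField F] [NumberField E] in
/-- **In the REGULAR HYPERBOLIC case the two roots are distinct**: for `c² = 1` and `a ∈ Eˣ` with
`c a · a ≠ 1`, `a ≠ (c a)⁻¹` (`d(a) = diag(a, ā⁻¹)` is a regular element of the split torus of `U(J₂)`).
[cite: Rogawski1990, §3.6 (p. 27)] -/
theorem hyperbolic_roots_ne_two {a : Eˣ} (ha : c (a : E) * (a : E) ≠ 1) : (a : E) ≠ (c (a : E))⁻¹ := by
  have ha0 : c (a : E) ≠ 0 := by
    rw [map_ne_zero_iff _ c.injective]; exact a.ne_zero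
  intro h
  apply ha
  have : c (a : E) * (c (a : E))⁻¹ = 1 := mul_inv_cancel₀ ha0
  rwa [← h] at this

omit [NumberField F] in
/-- **DICHOTOMY OF THE CLASSES MEETING `B(F)`** (`N = 2`): a class of the shape
`i = ((X − a)(X − (c a)⁻¹)).map (E → 𝔸_E)`, `a ∈ Eˣ`, is exactly one of
(u) CENTRAL × unipotent: `i = ((X − z)²).map`, `z ∈ E¹` — the class of the central element `z · 1` times the
unipotent variety (the unipotent term of `U(2)`, Rogawski Prop. 7.3.1);
(h) REGULAR HYPERBOLIC: `i = ((X − a)(X − (c a)⁻¹)).map` with `c a · a ≠ 1` — a regular semisimple class in the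
split torus direction (the weighted orbital integrals, Rogawski Prop. 6.4.1 for `U(2)`). This theorem is the
exhaustion; the exclusion is `not_central_and_hyperbolic_two`. There is no singular case in two variables.
[cite: Rogawski1990, §3.4–3.6 (pp. 23–27); §7.3 (p. 98)] [cite: Arthur1978TraceFormulaI, §8] -/
theorem meetsBorel_dichotomy {i : (AdeleRing (𝓞 E) E)[X]}
    (hi : ∃ a : Eˣ, i = ((X - C (a : E)) * (X - C (c (a : E))⁻¹)).map (algebraMap E (AdeleRing (𝓞 E) E))) :
    (∃ z : Eˣ, c (z : E) * (z : E) = 1 ∧ i = ((X - C (z : E)) ^ 2).map (algebraMap E (AdeleRing (𝓞 E) E))) ∨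
    (∃ a : Eˣ, c (a : E) * (a : E) ≠ 1 ∧
      i = ((X - C (a : E)) * (X - C (c (a : E))⁻¹)).map (algebraMap E (AdeleRing (𝓞 E) E))) := by
  obtain ⟨a, rfl⟩ := hi
  by_cases ha : c (a : E) * (a : E) = 1
  · -- `(c a)⁻¹ = a`
    have hinv : (c (a : E))⁻¹ = (a : E) := (eq_inv_of_mul_eq_one_right ha).symm
    refine Or.inl ⟨a, ha, ?_⟩
    rw [hinv]
    ring_nf
  · exact Or.inr ⟨a, ha, rfl⟩

omit [NumberField F] in
/-- **Exclusion (u)∕(h)**: a class is not both central and regular hyperbolic: the two distinct roots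
`a, (c a)⁻¹` cannot both equal `z`. [cite: Rogawski1990, §3.4–3.6 (pp. 23–27)] -/
theorem not_central_and_hyperbolic_two {i : (AdeleRing (𝓞 E) E)[X]}
    (h₁ : ∃ z : Eˣ, c (z : E) * (z : E) = 1 ∧ i = ((X - C (z : E)) ^ 2).map (algebraMap E (AdeleRing (𝓞 E) E)))
    (h₂ : ∃ a : Eˣ, c (a : E) * (a : E) ≠ 1 ∧
      i = ((X - C (a : E)) * (X - C (c (a : E))⁻¹)).map (algebraMap E (AdeleRing (𝓞 E) E))) :
    False := by
  obtain ⟨z, -, rfl⟩ := h₁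
  obtain ⟨a, ha, h⟩ := h₂
  have hE : (X - C (z : E)) ^ 2 = (X - C (a : E)) * (X - C (c (a : E))⁻¹) := map_adele_injective_two h
  have hE' : (X - C (z : E)) * (X - C (z : E)) = (X - C (a : E)) * (X - C (c (a : E))⁻¹) := by
    rw [show (X - C (z : E)) * (X - C (z : E)) = (X - C (z : E)) ^ 2 by ring, hE]
  have haz : (a : E) = z := by
    have hr : ((X - C (a : E)) * (X - C (c (a : E))⁻¹)).IsRoot (a : E) := isRoot_two_iff.2 (Or.inl rfl)
    rw [← hE', isRoot_two_iff] at hr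
    rcases hr with h | h <;> exact h
  have hwz : (c (a : E))⁻¹ = z := by
    have hr : ((X - C (a : E)) * (X - C (c (a : E))⁻¹)).IsRoot (c (a : E))⁻¹ := isRoot_two_iff.2 (Or.inr rfl)
    rw [← hE', isRoot_two_iff] at hr
    rcases hr with h | h <;> exact h
  exact hyperbolic_roots_ne_two ha (haz.trans hwz.symm)

/-- **The central case is the class of a rational CENTRAL element**: for `z ∈ E¹` the scalar `z · 1 ∈ Z(U(J₂))(F)`
lies in `B(F)` (indeed in `T(F)`) with `cl (z · 1) = ((X − z)²).map (E → 𝔸_E)`, so the class (u) of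
`meetsBorel_dichotomy` is `𝔬 ∋ z · 1` — the central elements times the unipotent variety.
[cite: Rogawski1990, §2.2 (p. 13); §3.4 (p. 23); §7.3 (p. 98)] -/
theorem exists_mem_arithmeticBorel_charpoly_eq_pow_two (hc : c * c = 1) (z : Eˣ)
    (hz : c (z : E) * (z : E) = 1) :
    ∃ β : (quasiSplit F E c 2).arithmeticSubgroup, β ∈ arithmeticBorel F E c 2 ∧
      (β : (quasiSplit F E c 2).Adelic) ∈ torusAdelic F E c 2 ∧
      ((adelicVal F E c 2 _ (β : (quasiSplit F E c 2).Adelic) : GL (Fin 2) (AdeleRing (𝓞 E) E)) :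
          Matrix (Fin 2) (Fin 2) (AdeleRing (𝓞 E) E)).charpoly =
        ((X - C (z : E)) ^ 2).map (algebraMap E (AdeleRing (𝓞 E) E)) := by
  obtain ⟨β, hβB, hβT, hβd⟩ := exists_mem_arithmeticBorel_charpoly_eq_two (F := F) hc z
  refine ⟨β, hβB, hβT, ?_⟩
  rw [hβd, (eq_inv_of_mul_eq_one_right hz).symm]
  congr 1
  ring

/-- **The hyperbolic case is the class of a rational REGULAR torus element**: for `a ∈ Eˣ` with `c a · a ≠ 1` the
diagonal `d(a) ∈ T(F) ≤ B(F)` has `cl d(a) = ((X − a)(X − (c a)⁻¹)).map (E → 𝔸_E)` with two distinct roots.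
[cite: Rogawski1990, §3.6 (p. 27); §6.4 (Prop. 6.4.1)] -/
theorem exists_mem_arithmeticBorel_charpoly_eq_hyperbolic_two (hc : c * c = 1) (a : Eˣ)
    (ha : c (a : E) * (a : E) ≠ 1) :
    ∃ β : (quasiSplit F E c 2).arithmeticSubgroup, β ∈ arithmeticBorel F E c 2 ∧
      (β : (quasiSplit F E c 2).Adelic) ∈ torusAdelic F E c 2 ∧
      ((adelicVal F E c 2 _ (β : (quasiSplit F E c 2).Adelic) : GL (Fin 2) (AdeleRing (𝓞 E) E)) :
          Matrix (Fin 2) (Fin 2) (AdeleRing (𝓞 E) E)).charpoly =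
        ((X - C (a : E)) * (X - C (c (a : E))⁻¹)).map (algebraMap E (AdeleRing (𝓞 E) E)) ∧
      (a : E) ≠ (c (a : E))⁻¹ := by
  obtain ⟨β, hβB, hβT, hβd⟩ := exists_mem_arithmeticBorel_charpoly_eq_two (F := F) hc a
  exact ⟨β, hβB, hβT, hβd, hyperbolic_roots_ne_two ha⟩

/-! ## §4 The Borel-refined index `cl♭ = (charpoly ∘ adelicVal, flag)` at `N = 2` and the two-way split -/

/-- **THE CLASSES MEETING `B(F)` FOR THE REFINED MAP `cl♭ = (charpoly ∘ adelicVal, flag)`** (`U(J₂)`, `c² = 1`):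
the NEGATION of the `B(F)`-missing filter predicate at `i = (j, flag)` holds iff `flag = true` AND
`j = ((X − a)(X − (c a)⁻¹)).map (E → 𝔸_E)` for some `a ∈ Eˣ` (★ `forall_arithmeticBorel_borelRefine_ne_iff`, every
`N`, + `not_forall_arithmeticBorel_charpoly_ne_iff_two`) — the index set of the two `N = 2` sockets.
[cite: Rogawski1990, §2.2–2.3 (pp. 13–14)] [cite: Arthur1978TraceFormulaI, §8] -/
theorem not_forall_arithmeticBorel_borelRefine_charpoly_ne_iff_two (hc : c * c = 1)
    (i : (AdeleRing (𝓞 E) E)[X] × Bool) :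
    (¬ ∀ β : ↥(arithmeticBorel F E c 2),
            (((adelicVal F E c 2 _ ((β : ↥(quasiSplit F E c 2).arithmeticSubgroup) : (quasiSplit F E c 2).Adelic) :
                GL (Fin 2) (AdeleRing (𝓞 E) E)) : Matrix (Fin 2) (Fin 2) (AdeleRing (𝓞 E) E)).charpoly,
              decide (∃ δ : ↥(quasiSplit F E c 2).arithmeticSubgroup,
                δ * (β : ↥(quasiSplit F E c 2).arithmeticSubgroup) * δ⁻¹ ∈ arithmeticBorel F E c 2)) ≠ i) ↔
    i.2 = true ∧ ∃ a : Eˣ,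
      i.1 = ((X - C (a : E)) * (X - C (c (a : E))⁻¹)).map (algebraMap E (AdeleRing (𝓞 E) E)) := by
  have h := forall_arithmeticBorel_borelRefine_ne_iff (F := F) (E := E) (c := c) (N := 2)
    (fun γ : ↥(quasiSplit F E c 2).arithmeticSubgroup =>
      ((adelicVal F E c 2 _ (γ : (quasiSplit F E c 2).Adelic) : GL (Fin 2) (AdeleRing (𝓞 E) E)) :
          Matrix (Fin 2) (Fin 2) (AdeleRing (𝓞 E) E)).charpoly) i
  rw [← not_forall_arithmeticBorel_charpoly_ne_iff_two (F := F) hc i.1]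
  constructor
  · intro hn
    refine ⟨?_, fun hall => hn (h.2 (Or.inr hall))⟩
    cases hb : i.2
    · exact absurd (h.2 (Or.inl hb)) hn
    · rfl
  · rintro ⟨hi2, hex⟩ hall
    rcases h.1 hall with h2 | h2
    · rw [hi2] at h2; exact Bool.noConfusion h2
    · exact hex h2

/-- A two-way split of a filtered finite sum: if the `Q`-elements are exactly the disjoint union of the `P₁`- and the
`P₂`-elements, then `∑_{Q} g = ∑_{P₁} g + ∑_{P₂} g`. [folklore] -/
private theorem sum_filter_eq_sum_filter_add_sum_filter_two {ι M : Type*} [AddCommMonoid M] (S : Finset ι)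
    (Q P₁ P₂ : ι → Prop) [DecidablePred Q] [DecidablePred P₁] [DecidablePred P₂] (g : ι → M)
    (h₁ : ∀ i, P₁ i → Q i) (h₂ : ∀ i, P₂ i → Q i) (hQ : ∀ i, Q i → P₁ i ∨ P₂ i)
    (h₁₂ : ∀ i, P₁ i → P₂ i → False) :
    ∑ i ∈ S.filter Q, g i = ∑ i ∈ S.filter P₁, g i + ∑ i ∈ S.filter P₂, g i := by
  classical
  rw [← Finset.sum_filter_add_sum_filter_not (S.filter Q) P₁, Finset.filter_filter, Finset.filter_filter]
  congr 1
  · exact Finset.sum_congr (Finset.filter_congr fun i _ => ⟨fun h => h.2, fun h => ⟨h₁ i h, h⟩⟩) fun _ _ => rfl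
  · exact Finset.sum_congr (Finset.filter_congr fun i _ =>
      ⟨fun h => by
        rcases hQ i h.1 with hp | hp
        · exact (h.2 hp).elim
        · exact hp,
       fun h => ⟨h₂ i h, fun h1 => h₁₂ i h1 h⟩⟩) fun _ _ => rfl

/-- **THE TWO SOCKETS OF `U(J₂)`, AS A SPLIT OF THE BOREL-MEETING SUM** (`c² = 1`): for any finite index set
`S ⊆ 𝔸_E[X] × Bool` and any summand `g`, the sum over the refined classes MEETING `B(F)` (the negation of the
`B(F)`-missing filter of the Borel-refined expansion) equals the sum over the CENTRAL × unipotent indices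
`(i.2 = true ∧ ∃ z ∈ E¹, i.1 = ((X − z)²).map)` plus the sum over the REGULAR HYPERBOLIC indices
`(i.2 = true ∧ ∃ a, c a·a ≠ 1 ∧ i.1 = ((X − a)(X − (c a)⁻¹)).map)` — `meetsBorel_dichotomy` +
`not_central_and_hyperbolic_two`, summand by summand. [cite: Rogawski1990, §2.2–2.3 (pp. 13–14); §7.3 (p. 98);
§10.2 (p. 153)] [cite: Arthur1978TraceFormulaI, §8] -/
theorem sum_filter_meetsBorel_eq_sum_central_add_sum_hyperbolic_two {M : Type*} [AddCommMonoid M]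
    (hc : c * c = 1) (S : Finset ((AdeleRing (𝓞 E) E)[X] × Bool)) (g : (AdeleRing (𝓞 E) E)[X] × Bool → M) :
    ∑ i ∈ S.filter (fun i => ¬ ∀ β : ↥(arithmeticBorel F E c 2),
            (((adelicVal F E c 2 _ ((β : ↥(quasiSplit F E c 2).arithmeticSubgroup) : (quasiSplit F E c 2).Adelic) :
                GL (Fin 2) (AdeleRing (𝓞 E) E)) : Matrix (Fin 2) (Fin 2) (AdeleRing (𝓞 E) E)).charpoly,
              decide (∃ δ : ↥(quasiSplit F E c 2).arithmeticSubgroup,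
                δ * (β : ↥(quasiSplit F E c 2).arithmeticSubgroup) * δ⁻¹ ∈ arithmeticBorel F E c 2)) ≠ i), g i =
      (∑ i ∈ S.filter (fun i : (AdeleRing (𝓞 E) E)[X] × Bool => i.2 = true ∧
            ∃ z : Eˣ, c (z : E) * (z : E) = 1 ∧
              i.1 = ((X - C (z : E)) ^ 2).map (algebraMap E (AdeleRing (𝓞 E) E))), g i) +
      (∑ i ∈ S.filter (fun i : (AdeleRing (𝓞 E) E)[X] × Bool => i.2 = true ∧
            ∃ a : Eˣ, c (a : E) * (a : E) ≠ 1 ∧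
              i.1 = ((X - C (a : E)) * (X - C (c (a : E))⁻¹)).map (algebraMap E (AdeleRing (𝓞 E) E))), g i) := by
  refine sum_filter_eq_sum_filter_add_sum_filter_two _ _ _ _ g (fun i hi => ?_) (fun i hi => ?_) (fun i hi => ?_)
    (fun i h₁ h₂ => not_central_and_hyperbolic_two (F := F) h₁.2 h₂.2)
  · -- central ⇒ meets `B(F)` with flag `true`
    obtain ⟨hi2, z, hz, hi1⟩ := hi
    refine (not_forall_arithmeticBorel_borelRefine_charpoly_ne_iff_two hc i).2 ⟨hi2, z, ?_⟩
    rw [hi1, (eq_inv_of_mul_eq_one_right hz).symm]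
    ring_nf
  · obtain ⟨hi2, a, -, hi1⟩ := hi
    exact (not_forall_arithmeticBorel_borelRefine_charpoly_ne_iff_two hc i).2 ⟨hi2, a, hi1⟩
  · obtain ⟨hi2, ha⟩ := (not_forall_arithmeticBorel_borelRefine_charpoly_ne_iff_two hc i).1 hi
    rcases meetsBorel_dichotomy (F := F) ha with h | h
    · exact Or.inl ⟨hi2, h⟩
    · exact Or.inr ⟨hi2, h⟩

end UnitaryGroup

end Literature.NumberTheory.Automorphic
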